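import Mathlib.LinearAlgebra.Matrix.Adjugate
import Mathlib.LinearAlgebra.Matrix.Determinant.Basic
import Mathlib.RingTheory.MvPolynomial.Ideal
import Mathlib.Data.Finset.Max
import Literature.RingTheory.MvPolynomial.MonomialCompleteIntersection
import HarnessLib

/-!
# Transition determinants between complete intersections in a polynomial ring (Wiebe's lemma)

Topic `Literature/RingTheory/CompleteIntersection`. Let `B = R[x₁, …, x_m]` and let
`f₁, …, f_m ∈ (x₁, …, x_m)` be written `fᵢ = ∑ⱼ cᵢⱼ xⱼ`. The classical facts about the
*transition determinant* `det c` (Wiebe 1969; Scheja–Storch, J. reine angew. Math. 278/279 (1975)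
§1; de Smit–Rubin–Schoof, *Criteria for complete intersections*, Prop. 2.1 "(Tate)") are that its
class modulo `(f)` does not depend on the choice of `c`, and that it is NOT in `(f)` as soon as
`(f)` is primary to the maximal ideal of the origin. We prove elementary polynomial-ring forms of
both, sufficient for the local duality of isolated zeros used in
`Literature/RingTheory/GradedAlgebra/IsolatedComponentRegularity*.lean`:

* `exists_koszul_of_sum_mul_X_eq_zero` — the syzygies of the variables are the Koszul relations
  (`H₁` of the Koszul complex of `x₁, …, x_m` vanishes): if `∑ⱼ rⱼ xⱼ = 0` then
  `rⱼ = ∑_{l>j} s_{jl} x_l − ∑_{l<j} s_{lj} x_l`;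
* `det_updateRow_koszul_mem_span` — a determinant one of whose rows is a Koszul relation
  `x_l e_j − x_j e_l`, the other rows `wᵢ` having `wᵢ · x = fᵢ`, lies in `(f)` (any commutative
  ring, `x_j` a non-zero-divisor);
* `det_sub_det_mem_span` — **independence of the transition determinant**: if `c x = c' x = f`
  (componentwise) then `det c − det c' ∈ (f)`;
* `det_notMem_span_sup_span_X_pow` — **Wiebe's lemma, polynomial form**: if `hᵢ = ∑ⱼ aᵢⱼ xⱼ` and
  `u xᵢᴺ = ∑ₖ bᵢₖ hₖ` for all `i` with `u(0) ≠ 0` (`R` a domain, `N ≥ 1`), then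
  `det a ∉ (h₁, …, h_m) + (x₁ᴺ, …, x_mᴺ)` (compare `det (b a)` with the diagonal transition
  `u xᵢᴺ = (u xᵢᴺ⁻¹) xᵢ`, and read off the coefficient of `∏ xᵢᴺ⁻¹`).

Everything is proved; no definitions, no named facts.

## References

* [DeSmitRubinSchoof1997] B. de Smit, K. Rubin, R. Schoof, *Criteria for complete intersections*,
  in: Modular Forms and Fermat's Last Theorem, Springer 1997, §2, Prop. 2.1 (Tate).
* H. Wiebe, *Über homologische Invarianten lokaler Ringe*, Math. Ann. 179 (1969) 257–274.
* G. Scheja, U. Storch, *Über Spurfunktionen bei vollständigen Durchschnitten*, J. reine angew.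
  Math. 278/279 (1975) 174–190, §1.
-/

noncomputable section

open MvPolynomial Matrix

namespace Literature.RingTheory.CompleteIntersection

/-! ### Determinants with a Koszul row -/

section AnyRing

variable {B : Type*} [CommRing B] {n : Type*} [Fintype n] [DecidableEq n]

/-- Linearity of the determinant in one row, summed over a finite set. [folklore] -/
theorem det_updateRow_finset_sum {ι : Type*} (M : Matrix n n B) (t : n) (S : Finset ι)
    (g : ι → n → B) :
    (M.updateRow t (∑ i ∈ S, g i)).det = ∑ i ∈ S, (M.updateRow t (g i)).det := by
  classical
  induction S using Finset.induction_on with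
  | empty =>
    rw [Finset.sum_empty, Finset.sum_empty]
    exact det_eq_zero_of_row_eq_zero t (fun k => by simp)
  | insert a S ha ih => rw [Finset.sum_insert ha, Finset.sum_insert ha, det_updateRow_add, ih]

/-- Linearity of the determinant in one column, summed over a finite set. [folklore] -/
theorem det_updateCol_finset_sum {ι : Type*} (M : Matrix n n B) (t : n) (S : Finset ι)
    (g : ι → n → B) :
    (M.updateCol t (∑ i ∈ S, g i)).det = ∑ i ∈ S, (M.updateCol t (g i)).det := by
  classical
  induction S using Finset.induction_on with
  | empty =>
    rw [Finset.sum_empty, Finset.sum_empty]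
    exact det_eq_zero_of_column_eq_zero t (fun k => by simp)
  | insert a S ha ih => rw [Finset.sum_insert ha, Finset.sum_insert ha, det_updateCol_add, ih]

/-- **A determinant with a Koszul row lies in `(f)`.** If row `t` of a square matrix is the Koszul
relation `x_l e_j − x_j e_l` (`j ≠ l`, `x_j` a non-zero-divisor) and every other row `wᵢ` satisfies
`wᵢ · x = fᵢ`, then the determinant lies in the ideal `(fᵢ)`. (Replace column `j` by `M x`, whose
entries are the `fᵢ` off row `t` and `0` in row `t`; this multiplies the determinant by `x_j` and
leaves the row `−x_j e_l`.) [cite: DeSmitRubinSchoof1997, Prop. 2.1] -/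
theorem det_updateRow_koszul_mem_span (M : Matrix n n B) (x f : n → B) (t : n) {j l : n}
    (hjl : j ≠ l) (hreg : ∀ y, x j * y = 0 → y = 0) (hrows : ∀ i, i ≠ t → ∑ k, M i k * x k = f i) :
    (M.updateRow t (x l • Pi.single j 1 - x j • Pi.single l 1)).det ∈ Ideal.span (Set.range f) := by
  set M₁ := M.updateRow t (x l • Pi.single j 1 - x j • Pi.single l 1) with hM₁
  -- the vector `M₁ x`
  have hv : ∀ k, ∑ i, x i • M₁ k i = if k = t then 0 else f k := by
    intro k
    by_cases hk : k = t
    · subst hk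
      rw [if_pos rfl]
      simp only [hM₁, updateRow_self, Pi.sub_apply, Pi.smul_apply, Pi.single_apply, smul_eq_mul,
        mul_ite, mul_one, mul_zero, mul_sub, Finset.sum_sub_distrib, Finset.sum_ite_eq',
        Finset.mem_univ, if_true]
      ring
    · rw [if_neg hk]
      simp only [hM₁, updateRow_ne hk, smul_eq_mul]
      rw [← hrows k hk]
      exact Finset.sum_congr rfl fun i _ => mul_comm _ _
  -- replacing column `j` by `M₁ x` multiplies the determinant by `x j`
  have h1 : (M₁.updateCol j fun k => if k = t then 0 else f k).det = x j * M₁.det := by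
    have := det_updateCol_sum M₁ j x
    simp only [hv] at this
    rw [this, smul_eq_mul]
  set M₂ := M₁.updateCol j fun k => if k = t then (0 : B) else f k with hM₂
  -- row `t` of `M₂` is `-x_j e_l`
  have hrow : M₂ t = (-x j) • Pi.single l (1 : B) := by
    funext k
    simp only [hM₂, hM₁, updateCol_apply, updateRow_self, Pi.sub_apply, Pi.smul_apply,
      Pi.single_apply, smul_eq_mul]
    by_cases hkj : k = j
    · subst hkj; simp [hjl]
    · rw [if_neg hkj]; split_ifs <;> simp
  set M₃ := M₂.updateRow t (Pi.single l (1 : B)) with hM₃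
  have h2 : M₂.det = -x j * M₃.det := by
    have : M₂ = M₂.updateRow t ((-x j) • Pi.single l (1 : B)) := by
      rw [← hrow]; exact (updateRow_eq_self M₂ t).symm
    rw [this, det_updateRow_smul]
  -- column `j` of `M₃` is `∑_{i ≠ t} fᵢ eᵢ`
  have hcol : (fun k => M₃ k j) = ∑ i ∈ Finset.univ.erase t, f i • Pi.single i (1 : B) := by
    funext k
    simp only [hM₃, Finset.sum_apply, Pi.smul_apply, Pi.single_apply, smul_eq_mul, mul_ite,
      mul_one, mul_zero]
    by_cases hk : k = t
    · subst hk
      rw [updateRow_self, Pi.single_apply, if_neg hjl, Finset.sum_eq_zero]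
      intro i hi
      rw [if_neg (Finset.ne_of_mem_erase hi).symm]
    · rw [updateRow_ne hk, hM₂, updateCol_self, if_neg hk, Finset.sum_ite_eq (Finset.univ.erase t) k,
        if_pos (Finset.mem_erase.mpr ⟨hk, Finset.mem_univ k⟩)]
  have h3 : M₃.det ∈ Ideal.span (Set.range f) := by
    have : M₃ = M₃.updateCol j (∑ i ∈ Finset.univ.erase t, f i • Pi.single i (1 : B)) := by
      rw [← hcol]; exact (updateCol_eq_self M₃ j).symm
    rw [this, det_updateCol_finset_sum]
    refine Ideal.sum_mem _ fun i _ => ?_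
    rw [det_updateCol_smul]
    exact Ideal.mul_mem_right _ _ (Ideal.subset_span ⟨i, rfl⟩)
  -- cancel `x j`
  have h4 : x j * (M₁.det + M₃.det) = 0 := by
    rw [mul_add, ← h1, h2]; ring
  have h5 : M₁.det = -M₃.det := eq_neg_of_add_eq_zero_left (hreg _ h4)
  rw [h5]
  exact Submodule.neg_mem _ h3

end AnyRing

/-! ### Syzygies of the variables -/

section Koszul

variable {R : Type*} [CommRing R] {m : ℕ}

/-- `x_j` is a non-zero-divisor modulo the ideal of the other variables: if `x_j p ∈ (x_l : l ∈ S)`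
with `j ∉ S` then `p ∈ (x_l : l ∈ S)` (look at supports). [folklore] -/
theorem mem_span_X_image_of_X_mul_mem {S : Set (Fin m)} {j : Fin m} (hj : j ∉ S)
    {p : MvPolynomial (Fin m) R} (h : X j * p ∈ Ideal.span (X '' S : Set (MvPolynomial (Fin m) R))) :
    p ∈ Ideal.span (X '' S : Set (MvPolynomial (Fin m) R)) := by
  rw [mem_ideal_span_X_image] at h ⊢
  intro mo hmo
  have hmem : Finsupp.single j 1 + mo ∈ (X j * p).support := by
    rw [support_X_mul]
    exact Finset.mem_map_of_mem _ hmo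
  obtain ⟨i, hi, hne⟩ := h _ hmem
  refine ⟨i, hi, ?_⟩
  have hij : i ≠ j := fun h => hj (h ▸ hi)
  simpa [Finsupp.single_apply, hij.symm] using hne

/-- Explicit coefficients for membership in the ideal of some variables. [folklore] -/
theorem exists_eq_sum_mul_X_of_mem_span {S : Finset (Fin m)} {p : MvPolynomial (Fin m) R}
    (h : p ∈ Ideal.span (X '' (S : Set (Fin m)) : Set (MvPolynomial (Fin m) R))) :
    ∃ t : Fin m → MvPolynomial (Fin m) R, p = ∑ l ∈ S, t l * X l := by
  classical
  have hS : (X '' (S : Set (Fin m)) : Set (MvPolynomial (Fin m) R)) =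
      Set.range fun l : S => (X (l : Fin m) : MvPolynomial (Fin m) R) := by
    ext q
    simp only [Set.mem_image, Finset.mem_coe, Set.mem_range, Subtype.exists, exists_prop]
  rw [hS, Ideal.mem_span_range_iff_exists_fun] at h
  obtain ⟨c, hc⟩ := h
  refine ⟨fun l => if hl : l ∈ S then c ⟨l, hl⟩ else 0, ?_⟩
  rw [← hc, ← Finset.sum_coe_sort S]
  refine Finset.sum_congr rfl fun l _ => ?_
  dsimp only
  rw [dif_pos l.2]

/-- **The syzygies of the variables are Koszul relations** (`H₁(x; R[x]) = 0`), on a finite set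
`S` of variables: if `∑_{j ∈ S} rⱼ xⱼ = 0` then there are `s_{jl}` with
`rⱼ = ∑_{l ∈ S, l > j} s_{jl} x_l − ∑_{l ∈ S, l < j} s_{lj} x_l` for every `j ∈ S` (induction on
`S`, removing its largest element). [folklore] -/
theorem exists_koszul_of_sum_mul_X_eq_zero (S : Finset (Fin m)) :
    ∀ r : Fin m → MvPolynomial (Fin m) R, ∑ j ∈ S, r j * X j = 0 →
      ∃ s : Fin m → Fin m → MvPolynomial (Fin m) R, ∀ j ∈ S,
        r j = (∑ l ∈ S, if j < l then s j l * X l else 0) -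
          ∑ l ∈ S, if l < j then s l j * X l else 0 := by
  classical
  induction S using Finset.induction_on_max with
  | empty => intro r _; exact ⟨0, fun j hj => absurd hj (Finset.notMem_empty j)⟩
  | insert j₀ S hlt ih =>
    intro r hr
    have hj₀ : j₀ ∉ S := fun h => lt_irrefl _ (hlt _ h)
    rw [Finset.sum_insert hj₀] at hr
    -- `r j₀ ∈ (x_l : l ∈ S)`
    have h1 : X j₀ * r j₀ ∈ Ideal.span (X '' (S : Set (Fin m)) : Set (MvPolynomial (Fin m) R)) := by
      have e : X j₀ * r j₀ = -∑ l ∈ S, r l * X l := by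
        rw [mul_comm]; exact eq_neg_of_add_eq_zero_left hr
      rw [e]
      exact Submodule.neg_mem _ (Ideal.sum_mem _ fun l hl =>
        Ideal.mul_mem_left _ _ (Ideal.subset_span ⟨l, hl, rfl⟩))
    obtain ⟨t, ht⟩ := exists_eq_sum_mul_X_of_mem_span
      (mem_span_X_image_of_X_mul_mem (by exact_mod_cast hj₀) h1)
    -- the corrected syzygy on `S`
    set r' : Fin m → MvPolynomial (Fin m) R := fun l => r l + t l * X j₀ with hr'
    have hr'0 : ∑ l ∈ S, r' l * X l = 0 := by
      have e : ∑ l ∈ S, r' l * X l = ∑ l ∈ S, r l * X l + (∑ l ∈ S, t l * X l) * X j₀ := by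
        rw [Finset.sum_mul, ← Finset.sum_add_distrib]
        exact Finset.sum_congr rfl fun l _ => by rw [hr']; ring
      rw [e, ← ht, ← hr]; ring
    obtain ⟨s', hs'⟩ := ih r' hr'0
    refine ⟨fun a b => if b = j₀ then -t a else s' a b, fun j hj => ?_⟩
    rcases Finset.mem_insert.mp hj with rfl | hjS
    · -- `j = j₀`: no larger element, and the smaller ones give `∑ t_l x_l`
      rw [Finset.sum_insert hj₀, Finset.sum_insert hj₀, if_neg (lt_irrefl _), zero_add, zero_add]
      dsimp only
      have e0 : ∑ l ∈ S, (if j < l then (if l = j then -t j else s' j l) * X l else 0) = 0 :=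
        Finset.sum_eq_zero fun l hl => if_neg (not_lt.mpr (hlt l hl).le)
      rw [e0, zero_sub, ht, ← Finset.sum_neg_distrib]
      refine Finset.sum_congr rfl fun l hl => ?_
      rw [if_pos (hlt l hl), if_pos rfl]; ring
    · have hjlt : j < j₀ := hlt j hjS
      have hne : j ≠ j₀ := hjlt.ne
      rw [Finset.sum_insert hj₀, Finset.sum_insert hj₀, if_pos hjlt, if_neg (not_lt.mpr hjlt.le),
        zero_add]
      dsimp only
      rw [if_pos rfl]
      have e1 : ∑ l ∈ S, (if j < l then (if l = j₀ then -t j else s' j l) * X l else 0) =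
          ∑ l ∈ S, if j < l then s' j l * X l else 0 :=
        Finset.sum_congr rfl fun l hl => by rw [if_neg (hlt l hl).ne]
      have e2 : ∑ l ∈ S, (if l < j then (if j = j₀ then -t l else s' l j) * X l else 0) =
          ∑ l ∈ S, if l < j then s' l j * X l else 0 :=
        Finset.sum_congr rfl fun l _ => by rw [if_neg hne]
      rw [e1, e2, add_sub_assoc, ← hs' j hjS]
      simp only [hr']
      ring

/-- The vector form of a Koszul combination: the `j`-th component of
`∑_{a<b} s_{ab} (x_b e_a − x_a e_b)`. [folklore] -/
theorem koszulVec_apply (s : Fin m → Fin m → MvPolynomial (Fin m) R) (j : Fin m) :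
    (∑ a : Fin m, ∑ b : Fin m, (if a < b then s a b else 0) •
        ((X b : MvPolynomial (Fin m) R) • (Pi.single a 1 : Fin m → MvPolynomial (Fin m) R) -
          (X a : MvPolynomial (Fin m) R) • (Pi.single b 1 : Fin m → MvPolynomial (Fin m) R)) :
        Fin m → MvPolynomial (Fin m) R) j =
      (∑ l, if j < l then s j l * X l else 0) - ∑ l, if l < j then s l j * X l else 0 := by
  simp only [Finset.sum_apply, Pi.smul_apply, Pi.sub_apply, Pi.single_apply, smul_eq_mul,
    mul_sub, mul_ite, mul_one, mul_zero, Finset.sum_sub_distrib]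
  congr 1
  · rw [Finset.sum_comm]
    simp only [Finset.sum_ite_eq, Finset.mem_univ, if_true]
    refine Finset.sum_congr rfl fun b _ => ?_
    split_ifs <;> ring
  · simp only [Finset.sum_ite_eq, Finset.mem_univ, if_true]
    refine Finset.sum_congr rfl fun a _ => ?_
    split_ifs <;> ring

/-! ### Independence of the transition determinant -/

/-- **Independence of the transition determinant modulo `(f)`.** In `B = R[x₁, …, x_m]`, if two
square matrices `c, c'` both satisfy `∑ₖ cᵢₖ xₖ = ∑ₖ c'ᵢₖ xₖ = fᵢ` for all `i`, then
`det c − det c' ∈ (f₁, …, f_m)`. (Exchange the rows one at a time; a difference of two such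
determinants is a determinant with a syzygy of `x` as a row, i.e. a combination of determinants
with a Koszul row.) [cite: DeSmitRubinSchoof1997, Prop. 2.1] -/
theorem det_sub_det_mem_span (c c' : Matrix (Fin m) (Fin m) (MvPolynomial (Fin m) R))
    (f : Fin m → MvPolynomial (Fin m) R) (hc : ∀ i, ∑ k, c i k * X k = f i)
    (hc' : ∀ i, ∑ k, c' i k * X k = f i) :
    c.det - c'.det ∈ Ideal.span (Set.range f) := by
  classical
  -- `N S` : rows in `S` from `c`, the others from `c'`
  let N : Finset (Fin m) → Matrix (Fin m) (Fin m) (MvPolynomial (Fin m) R) := fun S =>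
    Matrix.of fun i k => if i ∈ S then c i k else c' i k
  have hN : ∀ S : Finset (Fin m), (N S).det - c'.det ∈ Ideal.span (Set.range f) := by
    intro S
    induction S using Finset.induction_on with
    | empty =>
      have : N ∅ = c' := by ext i k; simp [N]
      rw [this, sub_self]; exact Ideal.zero_mem _
    | insert t S ht ih =>
      set r : Fin m → MvPolynomial (Fin m) R := fun k => c t k - c' t k with hr
      have e1 : N (insert t S) = (N S).updateRow t (fun k => c t k) := by
        ext i k
        by_cases hi : i = t
        · subst hi; simp [N, updateRow_self]
        · simp [N, Finset.mem_insert, hi]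
      have e2 : (N S).updateRow t (fun k => c' t k) = N S := by
        ext i k
        by_cases hi : i = t
        · subst hi; simp [N, updateRow_self, ht]
        · simp [N, updateRow_ne hi]
      have hdiff : (N (insert t S)).det - (N S).det = ((N S).updateRow t r).det := by
        have h := det_updateRow_add (N S) t r (fun k => c' t k)
        have e3 : (r + fun k => c' t k) = fun k => c t k := by
          funext k; simp [hr]
        rw [e3, e2] at h
        rw [e1, h]; ring
      -- the row `c t - c' t` is a syzygy of the variables
      have hsyz : ∑ j ∈ Finset.univ, r j * X j = 0 := by
        simp only [hr, sub_mul, Finset.sum_sub_distrib, hc t, hc' t, sub_self]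
      obtain ⟨s, hs⟩ := exists_koszul_of_sum_mul_X_eq_zero Finset.univ r hsyz
      have hvec : r = ∑ a, ∑ b, (if a < b then s a b else 0) •
          ((X b : MvPolynomial (Fin m) R) • (Pi.single a 1 : Fin m → MvPolynomial (Fin m) R) -
            (X a : MvPolynomial (Fin m) R) • (Pi.single b 1 : Fin m → MvPolynomial (Fin m) R)) := by
        funext j
        rw [koszulVec_apply, ← hs j (Finset.mem_univ j)]
      have hrows : ∀ i, i ≠ t → ∑ k, (N S) i k * X k = f i := by
        intro i _
        by_cases hi : i ∈ S
        · simp only [N, Matrix.of_apply, if_pos hi]; exact hc i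
        · simp only [N, Matrix.of_apply, if_neg hi]; exact hc' i
      have hmem : ((N S).updateRow t r).det ∈ Ideal.span (Set.range f) := by
        rw [hvec, det_updateRow_finset_sum]
        refine Ideal.sum_mem _ fun a _ => ?_
        rw [det_updateRow_finset_sum]
        refine Ideal.sum_mem _ fun b _ => ?_
        rw [det_updateRow_smul]
        by_cases hab : a < b
        · rw [if_pos hab]
          exact Ideal.mul_mem_left _ _ (det_updateRow_koszul_mem_span (N S) X f t hab.ne
            (fun y hy => (X_mul_cancel_left_iff (i := a)).mp (hy.trans (mul_zero _).symm)) hrows)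
        · rw [if_neg hab, zero_mul]; exact Ideal.zero_mem _
      have : (N (insert t S)).det - c'.det =
          ((N (insert t S)).det - (N S).det) + ((N S).det - c'.det) := by ring
      rw [this, hdiff]
      exact Ideal.add_mem _ hmem ih
  have htop : N Finset.univ = c := by ext i k; simp [N]
  simpa [htop] using hN Finset.univ

/-! ### Wiebe's lemma -/

/-- Cramer: if `b h = F` componentwise then `det b · hₖ ∈ (F)`. [folklore] -/
theorem det_mul_mem_span_of_mulVec_eq {B : Type*} [CommRing B] {n : Type*} [Fintype n]
    [DecidableEq n] (b : Matrix n n B) (h F : n → B) (hb : ∀ i, ∑ k, b i k * h k = F i) (k : n) :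
    b.det * h k ∈ Ideal.span (Set.range F) := by
  have hmul : b *ᵥ h = F := funext fun i => hb i
  have e : b.det • h = b.adjugate *ᵥ F := by
    rw [← hmul, mulVec_mulVec, adjugate_mul, smul_mulVec, one_mulVec]
  have ek : b.det * h k = ∑ i, b.adjugate k i * F i := by
    have := congrFun e k
    simpa [Pi.smul_apply, smul_eq_mul, mulVec, dotProduct] using this
  rw [ek]
  exact Ideal.sum_mem _ fun i _ => Ideal.mul_mem_left _ _ (Ideal.subset_span ⟨i, rfl⟩)

/-- **Wiebe's lemma (polynomial form).** Let `R` be a domain, `hᵢ = ∑ⱼ aᵢⱼ xⱼ` in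
`R[x₁, …, x_m]`, and suppose `u xᵢᴺ = ∑ₖ bᵢₖ hₖ` for all `i`, with `N ≥ 1` and `u(0) ≠ 0`
(i.e. `(h)` is primary to the origin, locally). Then the transition determinant `det a` does not
lie in `(h₁, …, h_m) + (x₁ᴺ, …, x_mᴺ)`; in particular `det a ∉ (h)`: the socle element `det a`
of the local complete intersection `R[x]_{(x)}/(h)` is non-zero.
[cite: DeSmitRubinSchoof1997, Prop. 2.1 and Cor. 2.2] -/
theorem det_notMem_span_sup_span_X_pow [IsDomain R]
    (a b : Matrix (Fin m) (Fin m) (MvPolynomial (Fin m) R)) (h : Fin m → MvPolynomial (Fin m) R)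
    (u : MvPolynomial (Fin m) R) {N : ℕ} (hN : 1 ≤ N) (ha : ∀ i, h i = ∑ j, a i j * X j)
    (hb : ∀ i, u * X i ^ N = ∑ k, b i k * h k) (hu : coeff 0 u ≠ 0) :
    a.det ∉ Ideal.span (Set.range h) ⊔
      Ideal.span (Set.range fun i : Fin m => (X i : MvPolynomial (Fin m) R) ^ N) := by
  classical
  set J := Ideal.span (Set.range fun i : Fin m => (X i : MvPolynomial (Fin m) R) ^ N) with hJ
  set F : Fin m → MvPolynomial (Fin m) R := fun i => u * X i ^ N with hF
  have hFJ : Ideal.span (Set.range F) ≤ J :=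
    Ideal.span_le.mpr (by rintro _ ⟨i, rfl⟩; exact Ideal.mul_mem_left _ _ (Ideal.subset_span ⟨i, rfl⟩))
  intro hmem
  obtain ⟨g, hg, w, hw, hgw⟩ := Submodule.mem_sup.mp hmem
  -- (1) `u · det b · det a ∈ J`
  have h1 : u * b.det * a.det ∈ J := by
    rw [mul_assoc, ← hgw, mul_add, mul_add]
    refine Ideal.add_mem _ (Ideal.mul_mem_left _ _ ?_) (Ideal.mul_mem_left _ _ (Ideal.mul_mem_left _ _ hw))
    obtain ⟨g', rfl⟩ := Ideal.mem_span_range_iff_exists_fun.mp hg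
    rw [Finset.mul_sum]
    refine Ideal.sum_mem _ fun k _ => ?_
    rw [mul_left_comm]
    exact Ideal.mul_mem_left _ _ (hFJ (det_mul_mem_span_of_mulVec_eq b h F (fun i => (hb i).symm) k))
  -- (2) `det (b a)` and the diagonal transition are congruent modulo `(F) ⊆ J`
  set c' : Matrix (Fin m) (Fin m) (MvPolynomial (Fin m) R) :=
    Matrix.diagonal fun i => u * X i ^ (N - 1) with hc'
  have hba : ∀ i, ∑ k, (b * a) i k * X k = F i := by
    intro i
    have : ∑ k, (b * a) i k * X k = ∑ l, b i l * ∑ k, a l k * X k := by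
      simp only [Matrix.mul_apply, Finset.sum_mul, Finset.mul_sum]
      rw [Finset.sum_comm]
      exact Finset.sum_congr rfl fun k _ => Finset.sum_congr rfl fun l _ => by ring
    rw [this]
    simp only [← ha]
    exact (hb i).symm
  have hc'x : ∀ i, ∑ k, c' i k * X k = F i := by
    intro i
    rw [Finset.sum_eq_single i (fun k _ hk => by rw [hc', diagonal_apply_ne _ hk.symm, zero_mul])
      (fun hi => absurd (Finset.mem_univ i) hi), hc', diagonal_apply_eq, hF]
    simp only
    rw [mul_assoc, ← pow_succ, Nat.sub_add_cancel hN]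
  have h2 : (b * a).det - c'.det ∈ J := hFJ (det_sub_det_mem_span (b * a) c' F hba hc'x)
  -- (3) hence `u · det c' = u^(m+1) ∏ xᵢ^(N-1) ∈ J`
  have h3 : u * c'.det ∈ J := by
    have e : u * c'.det = u * b.det * a.det - u * ((b * a).det - c'.det) := by
      rw [det_mul]; ring
    rw [e]
    exact Ideal.sub_mem _ h1 (Ideal.mul_mem_left _ _ h2)
  have hdet : c'.det = u ^ m * ∏ i, (X i : MvPolynomial (Fin m) R) ^ (N - 1) := by
    rw [hc', det_diagonal, Finset.prod_mul_distrib, Finset.prod_const, Finset.card_univ,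
      Fintype.card_fin]
  -- (4) the coefficient of `∏ xᵢ^(N-1)` says otherwise
  set d : Fin m →₀ ℕ := ∑ i : Fin m, Finsupp.single i (N - 1) with hd
  have hprod : (∏ i, (X i : MvPolynomial (Fin m) R) ^ (N - 1)) = monomial d 1 := by
    rw [hd, monomial_sum_index, C_1, one_mul]
    exact Finset.prod_congr rfl fun i _ => X_pow_eq_monomial
  have hdi : ∀ i, d i = N - 1 := fun i => by
    rw [hd, Finsupp.coe_finsetSum, Finset.sum_apply,
      Finset.sum_eq_single i (fun j _ hji => Finsupp.single_eq_of_ne' hji)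
        (fun h => (h (Finset.mem_univ i)).elim), Finsupp.single_eq_same]
  have hcoeff : coeff d (u * c'.det) = coeff 0 (u ^ (m + 1)) := by
    rw [hdet, ← mul_assoc, ← pow_succ', hprod, coeff_mul_monomial', if_pos le_rfl, tsub_self, mul_one]
  have hne : coeff d (u * c'.det) ≠ 0 := by
    rw [hcoeff, ← constantCoeff_eq, map_pow, constantCoeff_eq]
    exact pow_ne_zero _ hu
  have hzero : coeff d (u * c'.det) = 0 := by
    have hsupp := (Literature.RingTheory.MvPolynomial.mem_span_X_pow_iff.mp h3)
    by_contra hne'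
    obtain ⟨i, hi⟩ := hsupp d (mem_support_iff.mpr hne')
    rw [hdi] at hi
    omega
  exact hne hzero

/-- **Wiebe's lemma, membership form**: if `hᵢ = ∑ⱼ aᵢⱼ xⱼ`, `u xᵢᴺ ∈ (h)` for all `i`, `N ≥ 1`
and `u(0) ≠ 0` (`R` a domain), then `det a ∉ (h) + (x₁ᴺ, …, x_mᴺ)`.
[cite: DeSmitRubinSchoof1997, Prop. 2.1 and Cor. 2.2] -/
theorem det_notMem_span_sup_span_X_pow_of_mem [IsDomain R]
    (a : Matrix (Fin m) (Fin m) (MvPolynomial (Fin m) R)) (h : Fin m → MvPolynomial (Fin m) R)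
    (u : MvPolynomial (Fin m) R) {N : ℕ} (hN : 1 ≤ N) (ha : ∀ i, h i = ∑ j, a i j * X j)
    (hb : ∀ i, u * X i ^ N ∈ Ideal.span (Set.range h)) (hu : coeff 0 u ≠ 0) :
    a.det ∉ Ideal.span (Set.range h) ⊔
      Ideal.span (Set.range fun i : Fin m => (X i : MvPolynomial (Fin m) R) ^ N) := by
  choose b hb' using fun i => Ideal.mem_span_range_iff_exists_fun.mp (hb i)
  exact det_notMem_span_sup_span_X_pow a (Matrix.of b) h u hN ha
    (fun i => by simpa only [Matrix.of_apply] using (hb' i).symm) hu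

/-- In particular, under the hypotheses of Wiebe's lemma, `det a ∉ (h₁, …, h_m)`: the transition
determinant is a NON-ZERO element (of the socle) of `R[x]/(h)`.
[cite: DeSmitRubinSchoof1997, Cor. 2.2] -/
theorem det_notMem_span_of_mem [IsDomain R]
    (a : Matrix (Fin m) (Fin m) (MvPolynomial (Fin m) R)) (h : Fin m → MvPolynomial (Fin m) R)
    (u : MvPolynomial (Fin m) R) {N : ℕ} (hN : 1 ≤ N) (ha : ∀ i, h i = ∑ j, a i j * X j)
    (hb : ∀ i, u * X i ^ N ∈ Ideal.span (Set.range h)) (hu : coeff 0 u ≠ 0) :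
    a.det ∉ Ideal.span (Set.range h) := fun hmem =>
  det_notMem_span_sup_span_X_pow_of_mem a h u hN ha hb hu (Ideal.mem_sup_left hmem)

end Koszul

end Literature.RingTheory.CompleteIntersection

end
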